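import Mathlib
import Summits.NavierStokesRegularity.NavierStokesRegularity.Theorems.TaoLadderRungTwoFlatGappedFrontRobustActiveZoneOn
import Summits.NavierStokesRegularity.NavierStokesRegularity.Theorems.TaoLadderRungTwoFlatGappedFrontRobustExactEnvelopeOn
import Summits.NavierStokesRegularity.NavierStokesRegularity.Theorems.TaoLadderRungTwoFlatGappedFrontRobustPseudoBoundsOn
import Summits.NavierStokesRegularity.NavierStokesRegularity.Theorems.TaoLadderRungThreeGappedFrontRobustCloseness
import HarnessLib

/-!
# Shift-set pseudo-flows `PseudoFlowOnShift 𝕊`: THE THREE CLOSENESS FACTS from the constant facts (core of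
  the K_B♭ assembly; helper for item stmt-NavierStokesRegularity-22988 `GappedFrontRobustV2Flat`, crux
  K_B♭ of route TaoLadderRungTwoFlat)

The `𝕊`-parametrised version of `Theorems/TaoLadderRungThreeGappedFrontRobustCloseness.lean` (p1 g10,
one-way `S`): it chains the `𝕊`-zone theorems (`exact_block_behind_envelope`,
`pseudoFlowOnShift_tail_on_window`, `pseudoFlowOnShift_active_zone`, `pseudoFlowOnShift_energy_le_three`,
`pseudoFlowOnShift_defect_integral_le`, `pseudoFlowOnShift_sub_lipschitz`) under SCALAR hypotheses on the
constants. Differences from `S`: the bottom/top flux conditions and the tail closing condition carry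
their backscatter parts (`…ExactEnvelopeOn`, `…TailZoneOn`), the tail needs the slowness clause
`hslow`, and `∑|α| ≤ m·m·|𝕊|`. `stepCloseness_core` concludes, for every ball start with admissible
slack, every `(η, η)`-pseudo-flow `S'` on `𝕊` over `[0, τ]` (`τ ≥ c`), every exact zero-slack flow `S`
on `[0, c]` from the same start and every exact step `(τ₁, a)` into the `ρ r`-ball: (front)
`|S'_{i₀,1}(τ₁) − S_{i₀,1}(τ₁)| ≤ σ a`; (ball) `w_k |S'_{i,1+k}(τ₁) − S_{i,1+k}(τ₁)| ≤ (1 − ρ) r a`;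
(envelope) `F'_{i,k}(s) ≤ env k` on `[0, τ₁]`.

HONEST FRAMING: a theorem about Tao-type MODEL lattice pseudo-flows (Tao 2016 §4 Lemma 4.1, §6.2–6.4)
on a general nearest-neighbour shift set; nothing here concerns the Navier–Stokes equations; nothing is
asserted about any table (p1 g12).
-/

noncomputable section

-- the sub-problem namespace `Summit.NavierStokesRegularity.NavierStokesRegularity` repeats the summit name by design (D-0017)
set_option linter.dupNamespace false

namespace Summit.NavierStokesRegularity.NavierStokesRegularity.Theorems

open Set MeasureTheory intervalIntegral Literature.Analysis.FluidPDE Literature.Analysis.FluidPDE.TaoCascade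

namespace GappedFrontRobustOn

variable {m : ℕ} {𝕊 : Finset (ℤ × ℤ × ℤ)}

/-- **THE THREE CLOSENESS FACTS FROM THE CONSTANT FACTS.** See the module docstring.
[cite: Tao2016AveragedNS, §4 Lemma 4.1 (4.5), (4.8)–(4.10); §6.2–6.4 Props. 6.3–6.5 (statement shape)] -/
theorem stepCloseness_core (h𝕊 : IsNearestNeighbourSet 𝕊) (h𝕊c : IsSlotClosed 𝕊)
    (h111 : ((1 : ℤ), (1 : ℤ), (1 : ℤ)) ∉ 𝕊) {ε₀ : ℝ} (hε : 0 < ε₀)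
    {α : Fin m → Fin m → Fin m → ℤ × ℤ × ℤ → ℝ} (hαc : IsCancellingCoeffOn 𝕊 α)
    (hα1 : ∀ (i₁ i₂ i₃ : Fin m) (μ : ℤ × ℤ × ℤ), μ ∈ 𝕊 → |α i₁ i₂ i₃ μ| ≤ 1)
    {i₀ : Fin m} {Z : Set (Fin m → ℤ → ℝ)} {w : ℤ → ℝ} {r ρ σ θ₀ θ c₀ c : ℝ} {env₀ env : ℤ → ℝ}
    (hr : 0 < r) (hρ1 : ρ ≤ 1) (hc : 0 < c) (hc₀c : c₀ ≤ c) (hθ₀' : θ₀ ≤ 1 / 2) (hw1 : ∀ k, 1 ≤ w k)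
    {C_T : ℝ} (hCT : 0 < C_T)
    (hzT : ∀ z ∈ Z, ∀ (i : Fin m) (k : ℤ), |z i k| ≤ C_T * (1 + (1 + ε₀) ^ (-(k : ℝ))))
    {k₁ : ℤ} {K₀ : ℝ} (hK₀ : 0 ≤ K₀)
    (hT1 : ∀ k : ℤ, k₁ ≤ k → 2 * (1 + ε₀) ^ (k : ℝ) * w k ≤ w (k + 1))
    (hT2 : ∀ k : ℤ, k₁ ≤ k → ∀ z ∈ Z, ∀ i : Fin m, 4 * (w k * |z i k|) ≤ r)
    (hH4a : ∀ k : ℤ, k₁ ≤ k → env₀ k ≤ K₀ * r ^ 2 / w (k - 1) ^ 2)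
    -- the front block and the shells behind it
    {kb kt : ℤ} {Estar C₁ : ℝ} (hk₁t : k₁ ≤ kt) (hkt1 : 1 ≤ kt) (hkb : kb ≤ -1)
    (hEstar : 1 / 2 * (m : ℝ) * (2 * C_T + r) ^ 2 * (1 + ε₀) ^ ((2 : ℝ) * kt) / ((1 + ε₀) ^ 2 - 1) ≤ Estar)
    (hE0 : 0 ≤ Estar) (hC₁ : 6 * (C_T + r) * (1 + ε₀) + 2 * Real.sqrt (2 * Estar + 2) ≤ C₁)
    (hdrift : ∀ n : ℤ, n ≤ kb →
      c * (2 * ((m : ℝ) * m * 𝕊.card) * (1 + ε₀) ^ ((5 : ℝ) * n / 2) *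
        (C₁ * (1 + ε₀) ^ (-(n : ℝ))) * (C₁ * (1 + ε₀) ^ (-(n : ℝ)))) ≤
        (C_T + r) * (1 + (1 + ε₀) ^ (-(n : ℝ))) / 2)
    (hbot : c * ((1 + ε₀) ^ ((5 : ℝ) * kb / 2) * coeffAbsOn (botShifts 𝕊) α *
        (2 * (C₁ * (1 + ε₀) ^ (-(kb : ℝ))) ^ 2 + 4 * (C₁ * (1 + ε₀) ^ (-(kb : ℝ))))) ≤ 1 / 4)
    (htopflux : c * ((1 + ε₀) ^ ((5 : ℝ) * kt / 2) * coeffAbsOn (botShifts 𝕊) α *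
        (4 * (Real.sqrt (2 * K₀) * r / w kt) + 2 * (Real.sqrt (2 * K₀) * r / w kt) ^ 2)) ≤ 1 / 4)
    -- the exact flow's envelope (shape facts)
    {A₀ D : ℤ → ℝ} (hD : ∀ k, D k = r / w (k - 1))
    (hA₀lo : ∀ k : ℤ, k ≤ kb → 2 * ((C_T + r) * (1 + (1 + ε₀) ^ (-(k : ℝ)))) ≤ A₀ k)
    (hA₀mid : ∀ k : ℤ, kb + 1 ≤ k → k ≤ kt →
      Real.sqrt (2 * (2 * Estar * (1 + ε₀) ^ (-(2 : ℝ) * kb) + 2)) ≤ A₀ k)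
    (hA₀hi : ∀ k : ℤ, kt + 1 ≤ k → Real.sqrt (2 * K₀) * r / w (k - 1) ≤ A₀ k)
    -- row sums and the profile
    {Γ ψmax ψ₀ ν : ℝ} (hΓ : 0 < Γ) (hψ₀ : 0 < ψ₀) (hψmax1 : ψmax ≤ 1)
    (hψ₀max : ψ₀ * Real.exp (4 * Γ * c) ≤ ψmax) (hν : ν = ψ₀ / 2)
    (hrow : ∀ P : ℝ, 0 ≤ P → P ≤ 1 → ∀ (i : Fin m) (n : ℤ),
      ∑ i₁, ∑ i₂, ∑ μ ∈ 𝕊, |α i₁ i₂ i μ| * (1 + ε₀) ^ ((5 : ℝ) * (n - μ.2.2) / 2) *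
        (D (n - μ.2.2 + μ.1) * (A₀ (n - μ.2.2 + μ.2.1) + 2 * P * D (n - μ.2.2 + μ.2.1)) +
          (A₀ (n - μ.2.2 + μ.1) + 2 * P * D (n - μ.2.2 + μ.1)) * D (n - μ.2.2 + μ.2.1)) ≤ Γ * D n)
    (hfrontT : ψmax * r ≤ σ * w 0 * (1 + ε₀) ^ (-(1 / 2 : ℝ)))
    (hballT : ψmax ≤ (1 - ρ) * (1 + ε₀) ^ (-(1 / 2 : ℝ)))
    -- the tail
    {k₂ : ℤ} {ϑ β₀ : ℝ} (hk₂k₁ : k₁ ≤ k₂ - 1) (hk₂2 : 2 ≤ k₂) (hβ₀ : 0 ≤ β₀)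
    (hthin : ∀ K : ℤ, k₂ ≤ K → (1 + ε₀) ^ ((5 : ℝ) * K / 2) * r * w (K - 1) ≤ ϑ * w (K - 2) ^ 2)
    (hclose : ∀ β : ℝ, 0 ≤ β → β ≤ β₀ → ∀ K : ℤ, k₂ ≤ K → ∀ x : ℝ,
      (x = Real.sqrt (2 * K₀) + 2 * ψmax ∨ x = ν) →
      2 * (Real.sqrt 2 * Real.sqrt (4 / 3 * m * (25 / 32 + β * (1 + ε₀) ^ ((2 : ℝ) * K))) /
          (2 * (1 + ε₀) ^ ((K - 1 : ℤ) : ℝ)) +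
        coeffAbsOn (botShifts 𝕊) α * c * (ϑ / (1 + ε₀) ^ ((5 : ℝ) / 2)) * x ^ 2) ≤ ν)
    (hslow : ∀ K : ℤ, k₂ ≤ K → ∀ x : ℝ, (x = Real.sqrt (2 * K₀) + 2 * ψmax ∨ x = ν) →
      (1 + ε₀) ^ ((5 : ℝ) * (K - 1 : ℤ) / 2) * coeffAbsOn (botShifts 𝕊) α * c *
        (x * r / w (K - 2)) ≤ 1 / 2)
    -- the envelope and its slack
    {E_env Csw : ℝ}
    (henv_hi : ∀ k : ℤ, k₂ ≤ k → r ^ 2 / w (k - 1) ^ 2 ≤ env k)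
    (henv_lo : ∀ k : ℤ, k < k₂ → E_env * (1 + ε₀) ^ ((2 : ℝ) * (k₂ - k)) ≤ env k)
    (hSWtail : ∀ (L : ℕ) (k : ℤ), k₂ - 1 ≤ k → slackWeight ε₀ θ c env L k ≤
      2 * c * (1 + ε₀) ^ (5 / 2 + θ) * 1 * ((1 + ε₀) ^ ((2 : ℝ) * k) * r ^ 2 / w k ^ 2))
    (hSWlow : ∀ (L : ℕ) (k : ℤ), k ≤ k₂ - 1 → slackWeight ε₀ θ c env L k ≤
      Csw * (1 + ε₀) ^ (-((1 / 2 + θ) * k)))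
    -- the margin and its budgets
    {η Ω₅ Ω₂ : ℝ} (hη : 0 < η) (hηg : η * (1 + ε₀) ^ ((2 : ℝ) * k₂) * c ≤ 1)
    (hηβ : η * (2 * c * (1 + ε₀) ^ (5 / 2 + θ) * 1) ≤ β₀)
    (hD2 : ∀ n : ℤ, n < k₂ →
      3 * ((A₀ n + 2 * ψmax * D n) ^ 2 / 2 + η * (Csw * (1 + ε₀) ^ (-((1 / 2 + θ) * n)))) ≤
        E_env * (1 + ε₀) ^ ((2 : ℝ) * (k₂ - n)))
    (hD1 : ∀ n : ℤ, n < k₂ →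
      c * (η * (1 + ε₀) ^ ((2 : ℝ) * n) *
        Real.sqrt (3 * ((A₀ n + 2 * ψmax * D n) ^ 2 / 2 + η * (Csw * (1 + ε₀) ^ (-((1 / 2 + θ) * n)))))) ≤
        ψ₀ * D n / 4)
    (hΩ₅0 : 0 ≤ Ω₅) (hΩ₂0 : 0 ≤ Ω₂)
    (hΩ₅ : ∀ n : ℤ, n < k₂ → (1 + ε₀) ^ ((5 : ℝ) * n / 2) * w (n - 1) ≤ Ω₅)
    (hΩ₂ : ∀ n : ℤ, n < k₂ → (1 + ε₀) ^ ((2 : ℝ) * n) * w (n - 1) ≤ Ω₂) :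
    ∀ (L : ℕ) (S₀ F₀ B₀ : Fin m → ℤ → ℝ), ballDesc Z w r S₀ F₀ →
      (∀ i k, 0 ≤ B₀ i k ∧ B₀ i k ≤ η * slackWeight ε₀ θ c env L k) →
      ∀ τ : ℝ, c ≤ τ → ∀ S' F' : Fin m → ℤ → ℝ → ℝ, PseudoFlowOnShift 𝕊 τ ε₀ α η η S₀ F₀ B₀ S' F' →
      ∀ S F : Fin m → ℤ → ℝ → ℝ,
        PseudoFlowOnShift 𝕊 c ε₀ α 0 0 S₀ (fun i k => (1 / 2) * S₀ i k ^ 2) (fun _ _ => 0) S F →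
      ∀ τ₁ a : ℝ, StepTo ε₀ θ₀ c₀ i₀ (ballDesc Z w (ρ * r)) (epochEnvelope env₀) S F τ₁ a →
        (1 + σ) * a ≤ |S i₀ 1 τ₁| →
          |S' i₀ 1 τ₁ - S i₀ 1 τ₁| ≤ σ * a ∧
          (∀ i k, w k * |S' i (1 + k) τ₁ - S i (1 + k) τ₁| ≤ (1 - ρ) * r * a) ∧
          (∀ s ∈ Icc 0 τ₁, ∀ i k, F' i k s ≤ env k) := by
  intro L S₀ F₀ B₀ hball hB τ hτc S' F' hP S F hE τ₁ a hstep _hmargin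
  have hq : 0 < 1 + ε₀ := by linarith
  have hq1 : 1 ≤ 1 + ε₀ := by linarith
  set q : ℝ := 1 + ε₀ with hqdef
  have hw : ∀ k, 0 < w k := fun k => lt_of_lt_of_le one_pos (hw1 k)
  have hD0 : ∀ k, 0 ≤ D k := fun k => by rw [hD k]; exact div_nonneg hr.le (hw _).le
  obtain ⟨z, hz, hzr⟩ := hball
  obtain ⟨hτ₁, hτ₁c₀, ha, haθ, _, -, hepoch⟩ := hstep
  have hτ₁c : τ₁ ≤ c := hτ₁c₀.trans hc₀c
  have hP1 := pseudoFlowOnShift_mono hP hτ₁ (hτ₁c.trans hτc)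
  have hE1 := pseudoFlowOnShift_mono hE hτ₁ hτ₁c
  have hIτ₁ : τ₁ ∈ Icc 0 τ₁ := ⟨hτ₁.le, le_rfl⟩
  -- the profile
  have hψmax0 : 0 ≤ ψmax := le_trans (by positivity) hψ₀max
  have hexp_le : ∀ s : ℝ, s ≤ c → ψ₀ * Real.exp (4 * Γ * s) ≤ ψmax := fun s hs =>
    le_trans (mul_le_mul_of_nonneg_left (Real.exp_le_exp.mpr
      (mul_le_mul_of_nonneg_left hs (by positivity))) hψ₀.le) hψ₀max
  have hψ₀ψmax : ψ₀ ≤ ψmax := by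
    have := hexp_le 0 hc.le; simpa using this
  have hν0 : 0 ≤ ν := by rw [hν]; positivity
  have hK0s : 0 ≤ Real.sqrt (2 * K₀) := Real.sqrt_nonneg _
  -- exact energies under the certificate's tail envelope (H4a ∘ epoch clause)
  have henvE : ∀ s ∈ Icc 0 τ₁, ∀ (i : Fin m) (k : ℤ), k₁ ≤ k → F i k s ≤ K₀ * r ^ 2 / w (k - 1) ^ 2 :=
    fun s hs i k hk => (hepoch s hs i k).trans (hH4a k hk)
  have hEamp : ∀ s ∈ Icc 0 τ₁, ∀ (i : Fin m) (k : ℤ), k₁ ≤ k →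
      |S i k s| ≤ Real.sqrt (2 * K₀) * r / w (k - 1) := fun s hs i k hk =>
    GappedFrontRobust.abs_le_of_half_sq_le (hE1.defect_lower i k s hs) (henvE s hs i k hk) hK₀ hr.le (hw _)
  -- [A] the exact flow's envelope below the hand-over region
  obtain ⟨hbehind, hblock⟩ := exact_block_behind_envelope h𝕊 h𝕊c h111 hE1 hτ₁ hε hαc hα1 hr hCT hK₀
    hτ₁c hw1 (hzT z hz) hzr henvE hk₁t hkt1 hkb hEstar hE0 hC₁ hdrift hbot htopflux
  have hA₀ : ∀ u ∈ Icc 0 τ₁, ∀ (j : Fin m) (k : ℤ), |S j k u| ≤ A₀ k := by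
    intro u hu j k
    rcases le_or_gt k kb with hk | hk
    · exact (hbehind j k hk u hu).trans (hA₀lo k hk)
    rcases le_or_gt k kt with hk' | hk'
    · exact (hblock u hu j k (by linarith) hk').trans (hA₀mid k (by linarith) hk')
    · exact (hEamp u hu j k (by linarith)).trans (hA₀hi k (by linarith))
  -- base of the tails: the exact flow at shell k₂ - 1
  have hbaseE : ∀ u ∈ Icc 0 τ₁, ∀ i : Fin m, |S i (k₂ - 1) u| ≤ Real.sqrt (2 * K₀) * r / w (k₂ - 2) := by
    intro u hu i
    have := hEamp u hu i (k₂ - 1) hk₂k₁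
    rwa [show k₂ - 1 - 1 = k₂ - 2 by ring] at this
  have hT2z : ∀ k : ℤ, k₁ ≤ k → ∀ i, 4 * (w k * |z i k|) ≤ r := fun k hk i => hT2 k hk z hz i
  -- the pseudo-flow's slack in the tail form
  set βP : ℝ := η * (2 * c * q ^ (5 / 2 + θ) * 1) with hβP
  have hβP0 : 0 ≤ βP := by have := Real.rpow_pos_of_pos hq (5 / 2 + θ); positivity
  have hB₀tail : ∀ i k, k₂ - 1 ≤ k → B₀ i k ≤ βP * q ^ ((2 : ℝ) * k) * r ^ 2 / w k ^ 2 := by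
    intro i k hk
    have h1 := (hB i k).2
    have h2 := mul_le_mul_of_nonneg_left (hSWtail L k hk) hη.le
    refine h1.trans (h2.trans (le_of_eq ?_))
    simp only [hβP]; ring
  -- [C] the exact flow's tail (tail zone with zero slack, base from H4a)
  have hEtail : ∀ K : ℤ, k₂ ≤ K → ∀ u ∈ Icc 0 τ₁, ∀ i : Fin m, |S i K u| ≤ ν * r / w (K - 1) := by
    have hB₀0 : ∀ (i : Fin m) (k : ℤ), k₂ - 1 ≤ k →
        (fun (_ : Fin m) (_ : ℤ) => (0 : ℝ)) i k ≤ 0 * q ^ ((2 : ℝ) * k) * r ^ 2 / w k ^ 2 := by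
      intro i k _; simp
    have hdev0 : ∀ s ∈ Icc 0 τ₁, ∀ i : Fin m,
        |S i (k₂ - 1) s - S i (k₂ - 1) s| ≤ 2 * ψmax * (r / w (k₂ - 2)) := by
      intro s _ i; simp only [sub_self, abs_zero]; have := hw (k₂ - 2); positivity
    exact (pseudoFlowOnShift_tail_on_window h𝕊 h𝕊c h111 hE1 hε hαc hr.le le_rfl hw hν0 hK0s hψmax0 hT1
      hT2z hzr hB₀0 hthin hk₂k₁ hk₂2 hτ₁c (hclose 0 le_rfl hβ₀) hslow hbaseE hIτ₁ hτ₁ hdev0).1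
  -- the pseudo-flow's tail on [0, t] from a weak deviation at the base shell
  have hPtail : ∀ t ∈ Icc 0 τ₁, 0 < t →
      (∀ s ∈ Icc 0 t, ∀ i : Fin m, |S' i (k₂ - 1) s - S i (k₂ - 1) s| ≤ 2 * ψmax * (r / w (k₂ - 2))) →
      (∀ K : ℤ, k₂ ≤ K → ∀ u ∈ Icc 0 t, ∀ i : Fin m, |S' i K u| ≤ ν * r / w (K - 1)) ∧
        (∀ K : ℤ, k₂ ≤ K → ∀ u ∈ Icc 0 t, ∑ i, F' i K u ≤ (ν * r / w (K - 1)) ^ 2 / 2) := by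
    intro t ht ht0 hdev
    have hβPle : βP ≤ β₀ := hηβ
    exact pseudoFlowOnShift_tail_on_window h𝕊 h𝕊c h111 hP1 hε hαc hr.le hβP0 hw hν0 hK0s hψmax0 hT1 hT2z
      hzr hB₀tail hthin hk₂k₁ hk₂2 hτ₁c (hclose βP hβP0 hβPle) hslow hbaseE ht ht0 hdev
  -- weak bounds at the base shell in the form the tail wants
  have hweak_base : ∀ t ∈ Icc 0 τ₁,
      (∀ s ∈ Icc 0 t, ∀ (j : Fin m) (k : ℤ), k < k₂ →
        |S' j k s - S j k s| ≤ 2 * (ψ₀ * Real.exp (4 * Γ * s)) * D k) →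
      ∀ s ∈ Icc 0 t, ∀ i : Fin m, |S' i (k₂ - 1) s - S i (k₂ - 1) s| ≤ 2 * ψmax * (r / w (k₂ - 2)) := by
    intro t ht hweak s hs i
    have h1 := hweak s hs i (k₂ - 1) (by linarith)
    have h2 := hexp_le s (by linarith [hs.2, ht.2])
    have h3 : D (k₂ - 1) = r / w (k₂ - 2) := by rw [hD, show k₂ - 1 - 1 = k₂ - 2 by ring]
    rw [h3] at h1
    have h4 : 0 ≤ r / w (k₂ - 2) := div_nonneg hr.le (hw _).le
    have h5 := mul_le_mul_of_nonneg_right h2 h4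
    linarith
  -- shared one-shell facts below the tail
  have hsmall_all : ∀ n : ℤ, n < k₂ → η * q ^ ((2 : ℝ) * n) * τ₁ ≤ 1 := by
    intro n hn
    have h1 : q ^ ((2 : ℝ) * n) ≤ q ^ ((2 : ℝ) * k₂) :=
      Real.rpow_le_rpow_of_exponent_le hq1 (by
        have : (n : ℝ) ≤ k₂ := by exact_mod_cast hn.le
        linarith)
    calc η * q ^ ((2 : ℝ) * n) * τ₁ ≤ η * q ^ ((2 : ℝ) * k₂) * c :=
          mul_le_mul (mul_le_mul_of_nonneg_left h1 hη.le) hτ₁c hτ₁.le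
            (mul_nonneg hη.le (Real.rpow_pos_of_pos hq _).le)
      _ ≤ 1 := hηg
  have hampP : ∀ u ∈ Icc 0 τ₁, ∀ (i : Fin m) (n : ℤ),
      |S' i n u - S i n u| ≤ 2 * (ψ₀ * Real.exp (4 * Γ * u)) * D n → |S' i n u| ≤ A₀ n + 2 * ψmax * D n := by
    intro u hu i n h1
    have h2 := hA₀ u hu i n
    have h3 := hexp_le u (by linarith [hu.2])
    have h4 : |S' i n u| ≤ |S i n u| + |S' i n u - S i n u| := by
      have := abs_add_le (S i n u) (S' i n u - S i n u); simpa using this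
    have h5 := mul_le_mul_of_nonneg_right h3 (hD0 n)
    linarith
  -- [D] the active zone (pseudo-flow S' against the exact flow S); Lipschitz constant from (4.5)
  obtain ⟨M₁, hM₁0, hM₁⟩ := pseudoFlowOnShift_uniform_bounds hP1 hq
  obtain ⟨M₂, hM₂0, hM₂⟩ := pseudoFlowOnShift_uniform_bounds hE1 hq
  set M : ℝ := max M₁ M₂ with hMdef
  have hM0 : 0 ≤ M := le_trans hM₁0 (le_max_left _ _)
  have hM : ∀ u ∈ Icc 0 τ₁, ∀ (j : Fin m) (k : ℤ),
      |S' j k u| ≤ M ∧ |S j k u| ≤ M ∧ Real.sqrt (F' j k u) ≤ M := fun u hu j k =>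
    ⟨(hM₁ u hu j k).1.trans (le_max_left _ _), (hM₂ u hu j k).1.trans (le_max_right _ _),
      (hM₁ u hu j k).2.2.1.trans (le_max_left _ _)⟩
  have hmmS : 0 ≤ (m : ℝ) * m * 𝕊.card :=
    mul_nonneg (mul_nonneg (Nat.cast_nonneg m) (Nat.cast_nonneg m)) (Nat.cast_nonneg _)
  set Lc : ℝ := (4 * ((m : ℝ) * m * 𝕊.card) * M * M * Ω₅ + η * M * Ω₂) / r with hLc
  have hLc0 : 0 ≤ Lc :=
    div_nonneg (add_nonneg (mul_nonneg (mul_nonneg (mul_nonneg (mul_nonneg (by norm_num) hmmS) hM0) hM0)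
      hΩ₅0) (mul_nonneg (mul_nonneg hη.le hM0) hΩ₂0)) hr.le
  have key := pseudoFlowOnShift_active_zone hP1 hE1 hτ₁ hq k₂ (D := D) (A₀ := A₀) (Γ := Γ) (ψ₀ := ψ₀)
    (L := Lc) hΓ hψ₀ hLc0 hD0 hA₀ ?htail ?hrow ?hdefect ?hlip
  case htail =>
    intro t ht hweak k hk u hu j
    rcases eq_or_lt_of_le ht.1 with ht0 | ht0
    · -- t = 0: same start state
      have hu0 : u = 0 := le_antisymm (ht0 ▸ hu.2) hu.1
      rw [hu0, hP1.init_S, hE1.init_S, sub_self, abs_zero]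
      exact mul_nonneg hψ₀.le (hD0 k)
    · have hPt := (hPtail t ht ht0 (hweak_base t ht hweak)).1 k hk u hu j
      have hEt := hEtail k hk u ⟨hu.1, hu.2.trans ht.2⟩ j
      have htri : |S' j k u - S j k u| ≤ |S' j k u| + |S j k u| := abs_sub _ _
      rw [hD k]
      have : ν * r / w (k - 1) + ν * r / w (k - 1) = ψ₀ * (r / w (k - 1)) := by rw [hν]; ring
      linarith
  case hrow =>
    intro i n _
    have hP0 : 0 ≤ ψ₀ * Real.exp (4 * Γ * τ₁) := by positivity
    exact hrow _ hP0 ((hexp_le τ₁ hτ₁c).trans hψmax1) i n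
  case hdefect =>
    intro t ht hweak i n hn
    have ha : ∀ u ∈ Icc 0 t, |S' i n u| ≤ A₀ n + 2 * ψmax * D n := fun u hu =>
      hampP u ⟨hu.1, hu.2.trans ht.2⟩ i n (hweak u hu i n hn)
    have hb : B₀ i n ≤ η * (Csw * q ^ (-((1 / 2 + θ) * n))) :=
      (hB i n).2.trans (mul_le_mul_of_nonneg_left (hSWlow L n (by linarith)) hη.le)
    have h1 := pseudoFlowOnShift_defect_integral_le hP1 hq hη.le hη.le i n ht ha hb (hsmall_all n hn)
    refine h1.trans ?_
    have hfac : 0 ≤ η * q ^ ((2 : ℝ) * n) *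
        Real.sqrt (3 * ((A₀ n + 2 * ψmax * D n) ^ 2 / 2 + η * (Csw * q ^ (-((1 / 2 + θ) * n))))) :=
      mul_nonneg (mul_nonneg hη.le (Real.rpow_pos_of_pos hq _).le) (Real.sqrt_nonneg _)
    calc _ ≤ c * (η * q ^ ((2 : ℝ) * n) *
          Real.sqrt (3 * ((A₀ n + 2 * ψmax * D n) ^ 2 / 2 + η * (Csw * q ^ (-((1 / 2 + θ) * n)))))) :=
          mul_le_mul_of_nonneg_right (ht.2.trans hτ₁c) hfac
      _ ≤ ψ₀ * D n / 4 := hD1 n hn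
  case hlip =>
    intro i n hn s hs t ht
    have h1 := pseudoFlowOnShift_sub_lipschitz h𝕊 hP1 hE1 hε.le hη.le hM i n hs ht
    refine h1.trans (mul_le_mul_of_nonneg_right ?_ (abs_nonneg _))
    -- (4 Cα q^{5n/2} M² + η q^{2n} M) ≤ Lc · D n
    have hCα : ∑ i₁, ∑ i₂, ∑ μ ∈ 𝕊, |α i₁ i₂ i μ| ≤ (m : ℝ) * m * 𝕊.card := sum_abs_coeffOn_le hα1 i
    have hw5 := hΩ₅ n hn
    have hw2 := hΩ₂ n hn
    have hwn := hw (n - 1)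
    rw [hD n, hLc, div_mul_div_comm, le_div_iff₀ (mul_pos hr hwn)]
    have h5 : 0 ≤ q ^ ((5 : ℝ) * n / 2) := (Real.rpow_pos_of_pos hq _).le
    have e1 : (4 * (∑ i₁, ∑ i₂, ∑ μ ∈ 𝕊, |α i₁ i₂ i μ|) * q ^ ((5 : ℝ) * n / 2) * M * M +
        η * q ^ ((2 : ℝ) * n) * M) * (r * w (n - 1)) =
        (4 * (∑ i₁, ∑ i₂, ∑ μ ∈ 𝕊, |α i₁ i₂ i μ|) * M * M * (q ^ ((5 : ℝ) * n / 2) * w (n - 1)) +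
          η * M * (q ^ ((2 : ℝ) * n) * w (n - 1))) * r := by ring
    rw [e1]
    refine mul_le_mul_of_nonneg_right ?_ hr.le
    have hMM : 0 ≤ M * M := mul_nonneg hM0 hM0
    have t1 : 4 * (∑ i₁, ∑ i₂, ∑ μ ∈ 𝕊, |α i₁ i₂ i μ|) * M * M * (q ^ ((5 : ℝ) * n / 2) * w (n - 1)) ≤
        4 * ((m : ℝ) * m * 𝕊.card) * M * M * Ω₅ := by
      have h3 : (∑ i₁, ∑ i₂, ∑ μ ∈ 𝕊, |α i₁ i₂ i μ|) * (q ^ ((5 : ℝ) * n / 2) * w (n - 1)) ≤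
          ((m : ℝ) * m * 𝕊.card) * Ω₅ := mul_le_mul hCα hw5 (mul_nonneg h5 hwn.le) hmmS
      calc 4 * (∑ i₁, ∑ i₂, ∑ μ ∈ 𝕊, |α i₁ i₂ i μ|) * M * M * (q ^ ((5 : ℝ) * n / 2) * w (n - 1))
          = 4 * (M * M) * ((∑ i₁, ∑ i₂, ∑ μ ∈ 𝕊, |α i₁ i₂ i μ|) *
              (q ^ ((5 : ℝ) * n / 2) * w (n - 1))) := by ring
        _ ≤ 4 * (M * M) * (((m : ℝ) * m * 𝕊.card) * Ω₅) :=
            mul_le_mul_of_nonneg_left h3 (mul_nonneg (by norm_num) hMM)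
        _ = 4 * ((m : ℝ) * m * 𝕊.card) * M * M * Ω₅ := by ring
    have t2 : η * M * (q ^ ((2 : ℝ) * n) * w (n - 1)) ≤ η * M * Ω₂ :=
      mul_le_mul_of_nonneg_left hw2 (mul_nonneg hη.le hM0)
    linarith
  -- [E] deviations at the checkpoint time, every shell
  have hdev_lt : ∀ (i : Fin m) (n : ℤ), n < k₂ → |S' i n τ₁ - S i n τ₁| ≤ ψmax * D n := by
    intro i n hn
    have h1 := key i n hn τ₁ hIτ₁
    have h2 := hexp_le τ₁ hτ₁c
    exact h1.trans (mul_le_mul_of_nonneg_right h2 (hD0 n))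
  have hweak_all : ∀ s ∈ Icc 0 τ₁, ∀ (j : Fin m) (k : ℤ), k < k₂ →
      |S' j k s - S j k s| ≤ 2 * (ψ₀ * Real.exp (4 * Γ * s)) * D k := by
    intro s hs j k hk
    have h1 := key j k hk s hs
    have : 0 ≤ ψ₀ * Real.exp (4 * Γ * s) * D k := mul_nonneg (mul_nonneg hψ₀.le (Real.exp_pos _).le) (hD0 k)
    linarith
  have hPtail₁ := hPtail τ₁ hIτ₁ hτ₁ (hweak_base τ₁ hIτ₁ hweak_all)
  have hdev_ge : ∀ (i : Fin m) (n : ℤ), k₂ ≤ n → |S' i n τ₁ - S i n τ₁| ≤ ψmax * D n := by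
    intro i n hn
    have hPt := hPtail₁.1 n hn τ₁ hIτ₁ i
    have hEt := hEtail n hn τ₁ hIτ₁ i
    have htri : |S' i n τ₁ - S i n τ₁| ≤ |S' i n τ₁| + |S i n τ₁| := abs_sub _ _
    rw [hD n]
    have e : ν * r / w (n - 1) + ν * r / w (n - 1) = ψ₀ * (r / w (n - 1)) := by rw [hν]; ring
    have h4 : ψ₀ * (r / w (n - 1)) ≤ ψmax * (r / w (n - 1)) :=
      mul_le_mul_of_nonneg_right hψ₀ψmax (div_nonneg hr.le (hw _).le)
    linarith
  have hdev : ∀ (i : Fin m) (n : ℤ), |S' i n τ₁ - S i n τ₁| ≤ ψmax * (r / w (n - 1)) := by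
    intro i n
    rw [← hD n]
    rcases lt_or_ge n k₂ with hn | hn
    · exact hdev_lt i n hn
    · exact hdev_ge i n hn
  -- a ≥ q^{-1/2}
  have haq : q ^ (-(1 / 2 : ℝ)) ≤ a :=
    le_trans (Real.rpow_le_rpow_of_exponent_le hq1 (by linarith)) haθ
  have hq12 : 0 < q ^ (-(1 / 2 : ℝ)) := Real.rpow_pos_of_pos hq _
  refine ⟨?_, fun i k => ?_, fun s hs i k => ?_⟩
  · -- (front)
    have h1 := hdev i₀ 1
    rw [show (1 : ℤ) - 1 = 0 by ring] at h1
    have hw0 := hw 0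
    have h2 : ψmax * (r / w 0) ≤ σ * q ^ (-(1 / 2 : ℝ)) := by
      rw [← mul_div_assoc, div_le_iff₀ hw0]
      calc ψmax * r ≤ σ * w 0 * q ^ (-(1 / 2 : ℝ)) := hfrontT
        _ = σ * q ^ (-(1 / 2 : ℝ)) * w 0 := by ring
    have hσ : 0 ≤ σ * q ^ (-(1 / 2 : ℝ)) := le_trans (by positivity) h2
    have hσ' : 0 ≤ σ := by
      by_contra hneg; push Not at hneg
      have : σ * q ^ (-(1 / 2 : ℝ)) < 0 := mul_neg_of_neg_of_pos hneg hq12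
      linarith
    calc |S' i₀ 1 τ₁ - S i₀ 1 τ₁| ≤ σ * q ^ (-(1 / 2 : ℝ)) := h1.trans h2
      _ ≤ σ * a := mul_le_mul_of_nonneg_left haq hσ'
  · -- (ball)
    have h1 := hdev i (1 + k)
    rw [show (1 : ℤ) + k - 1 = k by ring] at h1
    have hwk := hw k
    have h1ρ : 0 ≤ 1 - ρ := by linarith
    calc w k * |S' i (1 + k) τ₁ - S i (1 + k) τ₁| ≤ w k * (ψmax * (r / w k)) :=
          mul_le_mul_of_nonneg_left h1 hwk.le
      _ = ψmax * r := by field_simp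
      _ ≤ (1 - ρ) * q ^ (-(1 / 2 : ℝ)) * r := mul_le_mul_of_nonneg_right hballT hr.le
      _ ≤ (1 - ρ) * a * r := by
          refine mul_le_mul_of_nonneg_right (mul_le_mul_of_nonneg_left haq h1ρ) hr.le
      _ = (1 - ρ) * r * a := by ring
  · -- (envelope)
    rcases lt_or_ge k k₂ with hk | hk
    · -- below the tail: defect Grönwall with the amplitude bound on [0, τ₁]
      have ha' : ∀ u ∈ Icc 0 τ₁, |S' i k u| ≤ A₀ k + 2 * ψmax * D k := fun u hu =>
        hampP u hu i k (hweak_all u hu i k hk)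
      have hb : B₀ i k ≤ η * (Csw * q ^ (-((1 / 2 + θ) * k))) :=
        (hB i k).2.trans (mul_le_mul_of_nonneg_left (hSWlow L k (by linarith)) hη.le)
      have h1 := pseudoFlowOnShift_energy_le_three hP1 hq hη.le i k hIτ₁ ha' hb (hsmall_all k hk) s hs
      exact h1.trans ((hD2 k hk).trans (henv_lo k hk))
    · -- the tail: energy form of the tail zone
      have h1 := hPtail₁.2 k hk s hs
      have h2 : F' i k s ≤ ∑ j, F' j k s :=
        Finset.single_le_sum (f := fun j => F' j k s) (fun j _ => hP1.nonneg_F j k s hs) (Finset.mem_univ i)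
      have hν1 : ν ^ 2 / 2 ≤ 1 := by
        have hν1' : ν ≤ 1 := by rw [hν]; linarith [hψ₀ψmax.trans hψmax1]
        have : ν ^ 2 ≤ 1 := pow_le_one₀ hν0 hν1'
        linarith
      have hwk := hw (k - 1)
      have h3 : (ν * r / w (k - 1)) ^ 2 / 2 ≤ r ^ 2 / w (k - 1) ^ 2 := by
        rw [show (ν * r / w (k - 1)) ^ 2 / 2 = ν ^ 2 / 2 * (r ^ 2 / w (k - 1) ^ 2) by ring]
        have : 0 ≤ r ^ 2 / w (k - 1) ^ 2 := by positivity
        exact mul_le_of_le_one_left this hν1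
      exact h2.trans (h1.trans (h3.trans (henv_hi k hk)))

end GappedFrontRobustOn

end Summit.NavierStokesRegularity.NavierStokesRegularity.Theorems

end
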